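import Literature.Claims.NS.Cui2012

/-!
# C19 `Cui2012` — kernel refutation of the printed inference behind §4 Assertion 1, and of the
existential-reading inference behind §4 Assertion 2

Text of record: S. Cui, arXiv:1204.5040 **v2** (v3 = withdrawal notice), typed skeleton
`Literature.Claims.NS.Cui2012` (p459462 + append, commit 19fed8e453d1).

* `not_Assertion1Inference` — Step 5 at the abstract (F15) grain, fixed-constant reading R1
  (`Literature.Claims.NS.Cui2012.Assertion1Inference`, p. 14 l. 10–12: "The estimate (4.1) follows from (3.1)
  and (3.8) by using the inequalities `(1−ε)‖v₀‖_p ≤ ‖u₀‖_p ≤ (1+ε)‖v₀‖_p` and choosing `ε` sufficiently small").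
  Witness: a SATURATED base point — `p = 4`, `c = A = B = 1` (so (3.1) `A ≤ cB^p` is an equality); whatever
  `ε₀ > 0` Lemma 3.2 hands over, the admissible perturbed data `A' = 1 + ε₀` (`η = ε₀`, `δ = 0`), `B' = 1`
  (`ε = 0`) satisfy every hypothesis and violate (4.1) `A' ≤ cB'^p`.  `assertion1Inference_fails_at` records that
  the same happens at EVERY exponent `p > 3`, EVERY constant `c > 0` and EVERY `ε₀ > 0`, at the saturated base
  point `A = c`, `B = 1`: the inference has no slack to spend, which is the content of the gap (the set `G_p` of
  (4.1) with a fixed `C[·]` need not be open at a datum where (4.1) is an equality).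
* `not_Assertion2Inference` — Step 6′ at the abstract grain, existential reading R2
  (`Literature.Claims.NS.Cui2012.Assertion2Inference`, p. 14 l. 17: "where `M = sup_n C[κ_p(u₀ₙ)]‖u₀ₙ‖_p < ∞`"
  from per-term finiteness).  Witness: `aₙ = n`.

Both theorems are closed terms over Mathlib reals; axioms `propext`, `Classical.choice`, `Quot.sound`.
The PDE-level Step 5 (`Assertion1Printed p C`) is not decided here (the tree has no `L^p ∩ L²` solution map to
exhibit a saturating datum); what is decided is that its printed justification is an instance of a false
inference schema.  Refuter: ns-claims-refuter-8; filed under interim convention (b) by the paired salvage prover.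

WHAT THIS IS NOT: not a claim about NS regularity or blow-up; not a claim about any author beyond the typed
locator.
-/

-- The summit's canonical theorem namespace repeats the summit name (single-conjunct summit).
set_option linter.dupNamespace false

namespace Summit.NavierStokesRegularity.NavierStokesRegularity.Theorems.Cui2012

/-- The inference of p. 14 l. 10–12 fails at every exponent `p > 3`, every constant `c > 0` and every tolerance
`ε₀ > 0`, at the saturated base point `A = c`, `B = 1` ((3.1) with equality): the perturbed data `A' = (1+ε₀)c`,
`B' = 1`, `ε = 0`, `η = ε₀`, `δ = 0` obey (3.8)-with-Minkowski and the print's TWO-SIDED norm comparison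
`(1−ε)B ≤ B' ≤ (1+ε)B` (p. 14 l. 14–15; the typed schema keeps only the lower side), and violate (4.1).
[cite: Cui2012NSLpWithdrawn, §4 Assertion 1 p.14] -/
theorem assertion1Inference_fails_at (p c ε₀ : ℝ) (hc : 0 < c) (hε₀ : 0 < ε₀) :
    ∃ A' B' ε η δ : ℝ, 0 ≤ ε ∧ ε ≤ ε₀ ∧ 0 ≤ η ∧ η ≤ ε₀ ∧ 0 ≤ δ ∧ δ ≤ ε₀ ∧
      A' ≤ (1 + η) * c + δ ∧ (1 - ε) * 1 ≤ B' ∧ B' ≤ (1 + ε) * 1 ∧ ¬ A' ≤ c * B' ^ p := by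
  refine ⟨(1 + ε₀) * c, 1, 0, ε₀, 0, le_rfl, hε₀.le, hε₀.le, le_rfl, le_rfl, hε₀.le, by simp, by simp,
    by simp, ?_⟩
  rw [Real.one_rpow, mul_one, not_le]
  nlinarith

/-- **`¬ Assertion1Inference`** (Step 5, abstract grain, reading R1): instantiate the schema at `p = 4`,
`c = A = B = 1` and apply `assertion1Inference_fails_at`. [cite: Cui2012NSLpWithdrawn, §4 Assertion 1 p.14] -/
theorem not_Assertion1Inference : ¬ Literature.Claims.NS.Cui2012.Assertion1Inference := by
  intro h
  obtain ⟨ε₀, hε₀, hall⟩ :=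
    h 4 1 1 1 (by norm_num) (by norm_num) (by norm_num) (by rw [Real.one_rpow]; norm_num)
  obtain ⟨A', B', ε, η, δ, h1, h2, h3, h4, h5, h6, h7, h8, -, h9⟩ :=
    assertion1Inference_fails_at 4 1 ε₀ one_pos hε₀
  exact h9 (hall A' B' ε η δ h1 h2 h3 h4 h5 h6 (by simpa using h7) (by simpa using h8))

/-- **`¬ Assertion2Inference`** (Step 6′, abstract grain, reading R2): the sequence `aₙ = n` is nonnegative and
unbounded. [cite: Cui2012NSLpWithdrawn, §4 Assertion 2 p.14] -/
theorem not_Assertion2Inference : ¬ Literature.Claims.NS.Cui2012.Assertion2Inference := by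
  intro h
  obtain ⟨M, hM⟩ := h (fun n => (n : ℝ)) (fun n => Nat.cast_nonneg n)
  obtain ⟨n, hn⟩ := exists_nat_gt M
  exact absurd (hM n) (not_le.mpr hn)

end Summit.NavierStokesRegularity.NavierStokesRegularity.Theorems.Cui2012
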